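import Literature.Analysis.FluidPDE.HardSphereRegularGeometry
import HarnessLib

/-!
# The pair-reflection involution of hard-sphere configurations on the flat torus

Topic `Literature/Analysis/FluidPDE` (companion of `HardSpherePhaseSpace`, `HardSphereRegularGeometry`).  For an ordered pair
`(i, j)` of particles and an impact direction `ω`, the map `pairReflect i j ω` of a configuration of `N` spheres on
`𝕋^d`: positions point-reflected about `x_j` (`x_k ↦ x_j + (x_j − x_k)`), the pair's velocities elastically reflected
(`(v_i, v_j) ↦ reflectVel ω (v_i, v_j)`, i.e. replaced by the PRE-collisional velocities when `(v_i, v_j)` are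
post-collisional with impact direction `ω`), all other velocities kept.  This is the `N`-body form of the inverse-collision
involution `J(n̂, v, w) = (−n̂, v′, w′)` of kinetic theory (Cercignani–Illner–Pulvirenti 1994 §3.1 / §4.2: the collision
transformation is an involution preserving Lebesgue measure, kinetic energy and `|⟨n̂, v − w⟩|`), realised on configurations in
contact so that the partner `x_i = x_j + εω` is carried to `x_j − εω`:

* `pairReflect_pairReflect` — an involution (`i ≠ j`);
* `euclidDist_pairReflect`, `pairReflect_mem_hardSphereDomain_iff` — minimal-image distances, hence the hard core, are invariant
  (a point reflection of the torus is an isometry of the nearest-image distance);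
* `configEnergy_pairReflect` — the kinetic energy is invariant (hence every Gibbs density that is a function of the energy on
  the hard-sphere domain);
* `inner_neg_pairReflect_vel_sub` — the outgoing flux factor is invariant: `⟨−ω, v_i′ − v_j′⟩ = ⟨ω, v_i − v_j⟩`;
* `sepVec_pairReflect_of_contact` — at contact `sepVec x_i x_j = εω` (`ε < 1/2`, `‖ω‖ = 1`) the image pair has
  `sepVec = −εω`;
* `oddMark_pairReflect_of_contact` — consequently every J-ODD mark `Ψ(ε⁻¹ sepVec x_i x_j, pre-velocities)` (as in the
  contact statistics of the routes on `Summits/AtomisticToContinuum/HydrodynamicLimit`) changes sign under `pairReflect`.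

Used by the tube-parity argument for weighted odd contact statistics under the invariant Gibbs law (the change of variables
in the outgoing contact flux is NOT here: this file is pure configuration geometry/kinematics).

## References
* C. Cercignani, R. Illner, M. Pulvirenti, *The Mathematical Theory of Dilute Gases*, Springer (1994), §3.1, §4.2.
* I. Gallagher, L. Saint-Raymond, B. Texier, *From Newton to Boltzmann*, EMS (2013), Ch. 4 intro (hard spheres on `𝕋^d`,
  nearest-image distance).
-/

noncomputable section

open scoped InnerProductSpace BigOperators
open Set

namespace Literature.Analysis.FluidPDE

variable {d : Type*} [Fintype d] {N : ℕ}

/-- **The pair-reflection involution** of a configuration of `N` particles on `𝕋^d` for the ordered pair `(i, j)` and the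
impact direction `ω`: positions point-reflected about `x_j`, the pair's velocities `ω`-reflected (`reflectVel`), the other
velocities kept.  The `N`-body realisation of the inverse-collision involution `J`. [cite: CIP1994, §3.1] -/
def pairReflect (i j : Fin N) (ω : EuclideanSpace ℝ d) (z : Config N d (UnitAddTorus d)) : Config N d (UnitAddTorus d) :=
  fun k => ((z j).1 + ((z j).1 - (z k).1),
    if k = i then (reflectVel ω ((z i).2, (z j).2)).1
    else if k = j then (reflectVel ω ((z i).2, (z j).2)).2 else (z k).2)

/-- Positions under the pair reflection: `x_k ↦ x_j + (x_j − x_k)`. [folklore] -/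
@[simp] theorem pairReflect_fst (i j : Fin N) (ω : EuclideanSpace ℝ d) (z : Config N d (UnitAddTorus d)) (k : Fin N) :
    (pairReflect i j ω z k).1 = (z j).1 + ((z j).1 - (z k).1) := rfl

/-- The centre `x_j` is fixed. [folklore] -/
@[simp] theorem pairReflect_fst_right (i j : Fin N) (ω : EuclideanSpace ℝ d) (z : Config N d (UnitAddTorus d)) :
    (pairReflect i j ω z j).1 = (z j).1 := by simp

/-- Velocity of `i`: the first reflected velocity. [folklore] -/
theorem pairReflect_snd_left (i j : Fin N) (ω : EuclideanSpace ℝ d) (z : Config N d (UnitAddTorus d)) :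
    (pairReflect i j ω z i).2 = (reflectVel ω ((z i).2, (z j).2)).1 := by simp [pairReflect]

/-- Velocity of `j` (`i ≠ j`): the second reflected velocity. [folklore] -/
theorem pairReflect_snd_right {i j : Fin N} (hij : i ≠ j) (ω : EuclideanSpace ℝ d) (z : Config N d (UnitAddTorus d)) :
    (pairReflect i j ω z j).2 = (reflectVel ω ((z i).2, (z j).2)).2 := by simp [pairReflect, hij.symm]

/-- Velocities of the other particles are kept. [folklore] -/
theorem pairReflect_snd_other {i j k : Fin N} (hki : k ≠ i) (hkj : k ≠ j) (ω : EuclideanSpace ℝ d)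
    (z : Config N d (UnitAddTorus d)) : (pairReflect i j ω z k).2 = (z k).2 := by simp [pairReflect, hki, hkj]

/-- **The pair reflection is an involution** (`i ≠ j`). [cite: CIP1994, §3.1] -/
theorem pairReflect_pairReflect {i j : Fin N} (hij : i ≠ j) (ω : EuclideanSpace ℝ d) (z : Config N d (UnitAddTorus d)) :
    pairReflect i j ω (pairReflect i j ω z) = z := by
  funext k
  refine Prod.ext ?_ ?_
  · simp only [pairReflect_fst]; abel
  · have hv := reflectVel_reflectVel ω ((z i).2, (z j).2)
    by_cases hki : k = i
    · subst hki
      rw [pairReflect_snd_left, pairReflect_snd_left, pairReflect_snd_right hij, Prod.mk.eta, hv]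
    · by_cases hkj : k = j
      · subst hkj
        rw [pairReflect_snd_right hij, pairReflect_snd_left, pairReflect_snd_right hij, Prod.mk.eta, hv]
      · rw [pairReflect_snd_other hki hkj, pairReflect_snd_other hki hkj]

/-- **A point reflection of the torus is an isometry of the nearest-image distance**: all pair distances are invariant
under the pair reflection. [cite: GST2013, Ch. 4 intro] -/
theorem euclidDist_pairReflect (i j : Fin N) (ω : EuclideanSpace ℝ d) (z : Config N d (UnitAddTorus d)) (k l : Fin N) :
    Torus.euclidDist (pairReflect i j ω z k).1 (pairReflect i j ω z l).1 = Torus.euclidDist (z k).1 (z l).1 := by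
  rw [pairReflect_fst, pairReflect_fst, Torus.euclidDist_comm (z k).1, Torus.euclidDist_eq, Torus.euclidDist_eq]
  congr 2
  abel

/-- The norms of the torus separation vectors are invariant. [folklore] -/
theorem norm_sepVec_pairReflect (i j : Fin N) (ω : EuclideanSpace ℝ d) (z : Config N d (UnitAddTorus d)) (k l : Fin N) :
    ‖(Torus.geometry d).sepVec (pairReflect i j ω z k).1 (pairReflect i j ω z l).1‖ =
      ‖(Torus.geometry d).sepVec (z k).1 (z l).1‖ := by
  rw [Torus.norm_geometry_sepVec, Torus.norm_geometry_sepVec, euclidDist_pairReflect]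

/-- **The hard core is invariant** under the pair reflection. [folklore] -/
theorem pairReflect_mem_hardSphereDomain_iff (i j : Fin N) (ω : EuclideanSpace ℝ d) (ε : ℝ)
    (z : Config N d (UnitAddTorus d)) :
    pairReflect i j ω z ∈ hardSphereDomain (Torus.geometry d) N ε ↔ z ∈ hardSphereDomain (Torus.geometry d) N ε := by
  simp only [hardSphereDomain, mem_setOf_eq, norm_sepVec_pairReflect]

/-- **The kinetic energy is invariant** under the pair reflection (`i ≠ j`): only the pair's velocities change, by an
elastic reflection. [cite: CIP1994, §4.2] -/
theorem configEnergy_pairReflect {i j : Fin N} (hij : i ≠ j) (ω : EuclideanSpace ℝ d) (z : Config N d (UnitAddTorus d)) :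
    configEnergy (pairReflect i j ω z) = configEnergy z := by
  unfold configEnergy
  congr 1
  rw [← sub_eq_zero, ← Finset.sum_sub_distrib]
  rw [Finset.sum_eq_add i j hij]
  · rw [pairReflect_snd_left, pairReflect_snd_right hij]
    have := norm_sq_reflectVel_fst_add_norm_sq_reflectVel_snd ω ((z i).2, (z j).2)
    linarith
  · intro k _ hk
    rw [pairReflect_snd_other hk.1 hk.2, sub_self]
  · intro h; exact absurd (Finset.mem_univ i) h
  · intro h; exact absurd (Finset.mem_univ j) h

/-- **The outgoing flux factor is invariant**: `⟨−ω, v_i′ − v_j′⟩ = ⟨ω, v_i − v_j⟩` for the reflected pair (`ω ≠ 0`).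
[cite: CIP1994, §4.2] -/
theorem inner_neg_pairReflect_vel_sub {i j : Fin N} (hij : i ≠ j) {ω : EuclideanSpace ℝ d} (hω : ω ≠ 0)
    (z : Config N d (UnitAddTorus d)) :
    ⟪-ω, (pairReflect i j ω z i).2 - (pairReflect i j ω z j).2⟫_ℝ = ⟪ω, (z i).2 - (z j).2⟫_ℝ := by
  rw [pairReflect_snd_left, pairReflect_snd_right hij, inner_neg_left, inner_reflectVel_fst_sub_snd ω hω]
  ring

/-- **At contact the separation vector flips**: if `sepVec x_i x_j = εω` with `0 < ε < 1/2` and `‖ω‖ = 1` then the image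
pair has `sepVec = −εω` (the representative `εω` lies in the open cube, where `reprSym` is odd). [folklore] -/
theorem sepVec_pairReflect_of_contact {i j : Fin N} {ω : EuclideanSpace ℝ d} {ε : ℝ} (hε : 0 < ε) (hε2 : ε < 1 / 2)
    (hω : ‖ω‖ = 1) (z : Config N d (UnitAddTorus d)) (h : (Torus.geometry d).sepVec (z i).1 (z j).1 = ε • ω) :
    (Torus.geometry d).sepVec (pairReflect i j ω z i).1 (pairReflect i j ω z j).1 = -(ε • ω) := by
  rw [Torus.geometry_sepVec] at h ⊢
  rw [pairReflect_fst, pairReflect_fst, sub_self, add_zero,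
    show (z j).1 + ((z j).1 - (z i).1) - (z j).1 = -((z i).1 - (z j).1) by abel, Torus.reprSym_neg, h]
  intro c
  rw [h, PiLp.smul_apply, smul_eq_mul, abs_mul, abs_of_pos hε]
  calc ε * |ω c| ≤ ε * ‖ω‖ := mul_le_mul_of_nonneg_left (by simpa using PiLp.norm_apply_le ω c) hε.le
    _ = ε := by rw [hω, mul_one]
    _ < 1 / 2 := hε2

/-- **J-odd marks flip under the pair reflection at contact.**  If `Ψ(−n̂, reflectVel n̂ (v, w)) = −Ψ(n̂, v, w)` for unit
`n̂`, and the pair `(i, j)` is in contact, `sepVec x_i x_j = εω` (`0 < ε < 1/2`, `‖ω‖ = 1`), then the mark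
`Ψ(ε⁻¹ sepVec x_i x_j, reflectVel (sepVec x_i x_j) (v_i, v_j))` (impact direction and PRE-collisional velocities read off the
configuration, as in the routes' contact statistics) evaluated at `pairReflect i j ω z` is minus its value at `z`.
[cite: CIP1994, §3.1] -/
theorem oddMark_pairReflect_of_contact {i j : Fin N} (hij : i ≠ j) {ω : EuclideanSpace ℝ d} {ε : ℝ} (hε : 0 < ε)
    (hε2 : ε < 1 / 2) (hω : ‖ω‖ = 1) (Ψ : EuclideanSpace ℝ d × EuclideanSpace ℝ d × EuclideanSpace ℝ d → ℝ)
    (hΨodd : ∀ (n v w : EuclideanSpace ℝ d), ‖n‖ = 1 →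
      Ψ (-n, (reflectVel n (v, w)).1, (reflectVel n (v, w)).2) = -Ψ (n, v, w))
    (z : Config N d (UnitAddTorus d)) (h : (Torus.geometry d).sepVec (z i).1 (z j).1 = ε • ω) :
    Ψ (ε⁻¹ • (Torus.geometry d).sepVec (pairReflect i j ω z i).1 (pairReflect i j ω z j).1,
        (reflectVel ((Torus.geometry d).sepVec (pairReflect i j ω z i).1 (pairReflect i j ω z j).1)
          ((pairReflect i j ω z i).2, (pairReflect i j ω z j).2)).1,
        (reflectVel ((Torus.geometry d).sepVec (pairReflect i j ω z i).1 (pairReflect i j ω z j).1)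
          ((pairReflect i j ω z i).2, (pairReflect i j ω z j).2)).2) =
      -Ψ (ε⁻¹ • (Torus.geometry d).sepVec (z i).1 (z j).1,
        (reflectVel ((Torus.geometry d).sepVec (z i).1 (z j).1) ((z i).2, (z j).2)).1,
        (reflectVel ((Torus.geometry d).sepVec (z i).1 (z j).1) ((z i).2, (z j).2)).2) := by
  have hε0 : ε ≠ 0 := hε.ne'
  have hflip := sepVec_pairReflect_of_contact hε hε2 hω z h
  rw [hflip, h, pairReflect_snd_left, pairReflect_snd_right hij, Prod.mk.eta, ← neg_smul,
    reflectVel_smul (neg_ne_zero.2 hε0), reflectVel_smul hε0, reflectVel_reflectVel, smul_smul, smul_smul,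
    inv_mul_cancel₀ hε0, one_smul, mul_neg, inv_mul_cancel₀ hε0, neg_one_smul]
  -- `(v_i, v_j) = reflectVel ω (p_i, p_j)` with `(p_i, p_j) = reflectVel ω (v_i, v_j)`
  set p := reflectVel ω ((z i).2, (z j).2) with hp
  have hv : ((z i).2, (z j).2) = reflectVel ω p := by rw [hp, reflectVel_reflectVel]
  have key := hΨodd ω p.1 p.2 hω
  rw [Prod.mk.eta] at key
  rw [← key, ← hv]

end Literature.Analysis.FluidPDE

end
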